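import Summits.AtomisticToContinuum.FouriersLaw.Theses.EmbeddedDrudeMourre
import Summits.AtomisticToContinuum.FouriersLaw.Theses.FourierGreenKubo
import Literature.MathematicalPhysics.KineticTheory.InfiniteChainAbelWitness
-- The tree bridges `GreenKuboContinuation.greenKuboContinuation_of_abelWitnessAllT`,
-- `…abelWitnessAllT_of_greenKuboContinuation`, `…greenKuboContinuation_of_fourierGreenKubo`
-- (Theorems/EmbeddedDrudeMourreGreenKuboContinuationOfFourierGreenKubo.lean, p115442) and
-- `greenKuboContinuation_of_canonicalAbelLimit` (…OfCanonicalAbelLimit.lean, p117235) are RE-PROVED inline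
-- below (three lines each) instead of imported: their modules were accepted but not yet built on the
-- farm when this skeleton was checked (`remote:stale:unbuilt`).

/-!
# Line `Sketch` for crux `GreenKuboContinuation` (stmt-AtomisticToContinuum-12597) — lead a1 (eighth lead)

The only entry of `payload.lines` not in `payload.dead_lines` is `Sketch` =
`run/gate/evidence/stmt-AtomisticToContinuum-12597/20260815T233304Z-Sketch.lean`, the crux-ideate
round-1 ideator-k2 FIRST-LEMMAS SKETCH (evidence note, verbatim: "Sketch.lean (lean check rc0, 0 sorry):
AbelWitness, RealVitaliPropagation, PositivityByConnectedness (proved), AnalyticVanishingPropagation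
(proved), WeakDCResponseBound, InnovationCovarianceIdentity, OneCellInnovationForm,
greenKuboContinuation_of_allTemperature (proved)"). It was never triaged or crux-planned as a line
(no `Lines/Sketch.lean` in the crux directory; the evidence path is not mounted in a lead's jail); its
two cards became (a) line `temperature-blind-vitali-hurwitz` — DEAD (`Lines/temperature-blind-vitali-hurwitz-DEAD.md`,
lead c5) — and (b) card `thermal-innovation-random-walker` — FAILED triage r1 by all three triagers
(`TRIAGE-r1-{1,2,3}.md`: costume (iv), its transfer `AllTemperatureAbelWitness` ⊋ crux).

Its only composition concluding the crux is `greenKuboContinuation_of_allTemperature :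
AllTemperatureAbelWitness → GreenKuboContinuation` (corner hypothesis discarded). That composition is
ALREADY A TREE THEOREM: `GreenKuboContinuation.greenKuboContinuation_of_abelWitnessAllT`
(Theorems/EmbeddedDrudeMourreGreenKuboContinuationOfFourierGreenKubo.lean, p115442, lead c4). So the
faithful skeleton of this "line" has exactly ONE stub, `stub_allTemperatureAbelWitness` = all-`T`
Abelian Green–Kubo for the pinned doubly-quartic chain (Disproof §4 `AbelianGreenKuboAllT`), and the
composition below is one line.

## Status of the single stub (why the line is dead on registration, L5)

* `stub ≡ crux` modulo the route's own target: `stub_of_GreenKuboContinuation` below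
  (`DrudeDissolution → AbelOfSpectralDensity → GreenKuboContinuation → stub`; tree:
  `abelWitnessAllT_of_greenKuboContinuation`, p115442; Disproof §4
  `greenKuboContinuation_iff_allT_of_drude`). The "reduction" relocates 100 % of the crux's content into
  the stub and adds the corner temperatures on top (stub ⊋ crux).
* The stub is the conjunct's Green–Kubo content at every temperature of a deterministic anharmonic
  lattice — OPEN (Disproof VERDICT: "no theorem produces a positive finite conductivity for ANY
  deterministic anharmonic lattice"; BLR2000 §7). Named outside suppliers close the CRUX DIRECTLY,
  without this line: stmt-0703 (`GreenKuboContinuation_of_stmt0703` below; tree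
  `greenKuboContinuation_of_fourierGreenKubo`, p115442) and the canonical all-`T` Abel limit (tree
  `greenKuboContinuation_of_canonicalAbelLimit`, p117235, lead c5).
* `Leans on:` of the k2 sketch (RealVitaliPropagation & co.) were all landed by leads -0 … c2
  (p72547, p78745, p108530 …) and serve the DEAD vitali line; none supplies the stub.

Registered so that the record shows the stub list of the last remaining "line"; see
`Lines/Sketch.dead.md`.
-/

noncomputable section

namespace Summit.AtomisticToContinuum.FouriersLaw.Cruxes.GreenKuboContinuation.Sketch

open MeasureTheory Filter Set Topology
open Literature.MathematicalPhysics.KineticTheory.HeatConduction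
open Summit.AtomisticToContinuum.FouriersLaw.Theses.EmbeddedDrudeMourre

/-- STUB (the line's only one; = k2 Sketch `AllTemperatureAbelWitness` = Disproof §4
`AbelianGreenKuboAllT`, witness clause verbatim from the route decl): at EVERY `T > 0` the pinned
chain `pinnedChain ω₂ lam β γ` has an Abelian Green–Kubo witness — a DLR Gibbs state `μT`, a
`μT`-preserving infinite-volume dynamics with absolutely convergent summed current autocorrelation
`C`, and `κ > 0` with `T⁻² ∫₀^∞ e^{-νt} C(t) dt → κ` as `ν ↓ 0`. OPEN PROBLEM (all-temperature
Green–Kubo content of the conjunct; Abelian shadow of stmt-0703). -/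
theorem stub_allTemperatureAbelWitness :
    ∀ ω₂ lam β γ : ℝ, 0 < ω₂ → 0 < lam → 0 < β → 0 < γ → ∀ T : ℝ, 0 < T →
      ∃ (μT : Measure ChainConfig) (D : InfiniteChainDynamics (pinnedChain ω₂ lam β γ)) (κ : ℝ),
        (pinnedChain ω₂ lam β γ).IsChainGibbsMeasure T μT ∧ D.PreservesMeasure μT ∧
        (∀ t : ℝ, D.HasAbsConvergentCorrelation μT t) ∧ 0 < κ ∧
        Tendsto (fun ν : ℝ => (T ^ 2)⁻¹ * ∫ t in Ioi (0 : ℝ),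
            Real.exp (-(ν * t)) * D.currentCorrelation μT t) (𝓝[>] (0 : ℝ)) (𝓝 κ) := by
  sorry

/-- COMPOSITION (= k2 Sketch `greenKuboContinuation_of_allTemperature`; in tree as
`GreenKuboContinuation.greenKuboContinuation_of_abelWitnessAllT`, p115442): the all-`T` witness
statement gives the crux — the corner hypothesis `_hcorner` is discarded. -/
theorem GreenKuboContinuation_of
    (h : ∀ ω₂ lam β γ : ℝ, 0 < ω₂ → 0 < lam → 0 < β → 0 < γ → ∀ T : ℝ, 0 < T →
      ∃ (μT : Measure ChainConfig) (D : InfiniteChainDynamics (pinnedChain ω₂ lam β γ)) (κ : ℝ),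
        (pinnedChain ω₂ lam β γ).IsChainGibbsMeasure T μT ∧ D.PreservesMeasure μT ∧
        (∀ t : ℝ, D.HasAbsConvergentCorrelation μT t) ∧ 0 < κ ∧
        Tendsto (fun ν : ℝ => (T ^ 2)⁻¹ * ∫ t in Ioi (0 : ℝ),
            Real.exp (-(ν * t)) * D.currentCorrelation μT t) (𝓝[>] (0 : ℝ)) (𝓝 κ)) :
    Summit.AtomisticToContinuum.FouriersLaw.Theses.EmbeddedDrudeMourre.GreenKuboContinuation := by
  intro ω₂ lam β γ hω hl hβ hγ _T₀ _hT₀ _hcorner T hT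
  exact h ω₂ lam β γ hω hl hβ hγ T hT

/-- DEATH CERTIFICATE, kernel-visible (tree: `abelWitnessAllT_of_greenKuboContinuation`, p115442;
Disproof §4 `greenKuboContinuation_iff_allT_of_drude`): modulo the route's own target
`DrudeDissolution` and the CLOSED support `AbelOfSpectralDensity` (stmt-12598), the crux gives the stub
back — the line's single stub is EQUIVALENT to the crux on the route: the line performs no reduction. -/
theorem stub_of_GreenKuboContinuation (hDD : DrudeDissolution) (hA : AbelOfSpectralDensity)
    (hC : GreenKuboContinuation) :
    ∀ ω₂ lam β γ : ℝ, 0 < ω₂ → 0 < lam → 0 < β → 0 < γ → ∀ T : ℝ, 0 < T →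
      ∃ (μT : Measure ChainConfig) (D : InfiniteChainDynamics (pinnedChain ω₂ lam β γ)) (κ : ℝ),
        (pinnedChain ω₂ lam β γ).IsChainGibbsMeasure T μT ∧ D.PreservesMeasure μT ∧
        (∀ t : ℝ, D.HasAbsConvergentCorrelation μT t) ∧ 0 < κ ∧
        Tendsto (fun ν : ℝ => (T ^ 2)⁻¹ * ∫ t in Ioi (0 : ℝ),
            Real.exp (-(ν * t)) * D.currentCorrelation μT t) (𝓝[>] (0 : ℝ)) (𝓝 κ) := by
  intro ω₂ lam β γ hω hl hβ hγ
  obtain ⟨T₀, hT₀, hdiss⟩ := hDD ω₂ lam β γ hω hl hβ hγ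
  refine hC ω₂ lam β γ hω hl hβ hγ T₀ hT₀ fun T hT hTlt => ?_
  obtain ⟨μT, D, hG, hP, hAC, σ, hσ, hCσ, δ, g, hδ, hg, hg0, hgpos, hac⟩ := hdiss T hT hTlt
  exact ⟨μT, D, (T ^ 2)⁻¹ * (Real.pi * g 0), hG, hP, hAC,
    mul_pos (inv_pos.mpr (pow_pos hT 2)) (mul_pos Real.pi_pos hgpos),
    (hA σ (D.currentCorrelation μT) δ g hσ hδ hCσ hg hg0 hac).const_mul ((T ^ 2)⁻¹)⟩

/-- OUTSIDE SUPPLIER 1 closes the crux WITHOUT the line: stmt-0703 (`FourierGreenKubo`: an `L¹`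
Green–Kubo pair at every `T`; Abel summation by dominated convergence,
`InfiniteChainDynamics.HasGreenKubo.tendsto_abel`). Tree: `greenKuboContinuation_of_fourierGreenKubo`
(p115442). -/
theorem GreenKuboContinuation_of_stmt0703
    (h : Summit.AtomisticToContinuum.FouriersLaw.Theses.FourierGreenKubo.FourierGreenKubo) :
    GreenKuboContinuation := by
  refine GreenKuboContinuation_of fun ω₂ lam β γ hω hl hβ hγ T hT => ?_
  obtain ⟨μ, hG, D, hP, hGK⟩ := h ω₂ lam β γ hω hl hβ hγ T hT
  exact ⟨μ, D, D.greenKuboConductivity μ T, hG, hP, hGK.1, hGK.pos, hGK.tendsto_abel⟩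

/-- Sanity link for the audit: the composition applied to the stub proves the crux decl by name
(this term carries the stub's `sorry` and is NOT a proof claim). -/
theorem GreenKuboContinuation_proof :
    Summit.AtomisticToContinuum.FouriersLaw.Theses.EmbeddedDrudeMourre.GreenKuboContinuation :=
  GreenKuboContinuation_of stub_allTemperatureAbelWitness

end Summit.AtomisticToContinuum.FouriersLaw.Cruxes.GreenKuboContinuation.Sketch

end
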